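import Summits.KontsevichZagierPeriods.KontsevichZagierPeriods.Theorems.SymplecticScissorsRealOnePeriodRelationsStubTorsUnitCore

/-!
# Crux `RealOnePeriodRelations` (stmt-KontsevichZagierPeriods-10042), line `nash-retraction-thin-strip`, reshape 10:
# the torsion units `G_±` and the dlog identity — assembly of the lead's stub `stub_torsUnit` from the two worker statements

From the statements of the registered stubs `stub_torsPolyExists` (hypothesis `hPoly`) and `stub_ellipticLiouville` (hypothesis
`hLiou`) this file proves the full conclusion of `stub_torsUnit` (`torsUnit_of`): for an algebraic torsion point `v`
(`N v ∈ Λ`, `2v ∉ Λ`) there are `G₊, G₋ ∈ ℚ̄[x, y]` with `G₊ G₋ = c (℘ − ℘ v)^N` along `φ` (`c ∈ ℚ̄ˣ`) and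
`dlog G₊ − dlog G₋ = N ℘′(v)/(℘ − ℘ v) − 2λ`, `λ = N ζ(v) − η(Nv) ∈ ℚ̄`:
`G_± ∘ φ = c_± · sigmaQuot L (±v) N (±η)` (`…StubTorsUnitCore`), the `σ`-formula `℘ z − ℘ v = −σ(z−v)σ(z+v)/(σ(z)²σ(v)²)`
(`PeriodPair.weierstrassP_sub_eq_sigma_holds`), the addition theorem for `ζ` (`PeriodPair.weierstrassZeta_add_holds`) and the
algebraicity of `N ζ(v) − η(Nv)` at torsion points (`PeriodPair.torsion_dichotomy`).
[cite: WhittakerWatson1927, §20.53, §20.41] [cite: SilvermanAEC2009, III.3.5] [cite: HuberWustholz2022, §18.1]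
-/

noncomputable section

open scoped BigOperators Topology PeriodPair
open Set Filter MvPolynomial Complex
open Literature.NumberTheory.Transcendental Literature.NumberTheory.Transcendental.CurvePeriods
open Literature.NumberTheory.Transcendental.CurvePeriods.Ell

namespace Summit.KontsevichZagierPeriods.SymplecticScissors.RealOnePeriodRelations

namespace TorsionLayer

/-- `ζ(z − v) − ζ(z + v) = ℘′(v)/(℘ z − ℘ v) − 2 ζ(v)` for `z, v ∉ Λ` with `℘ z ≠ ℘ v` (the addition theorem for `ζ` twice).
[cite: WhittakerWatson1927, §20.41] -/
theorem zeta_sub_sub_zeta_add : ∀ (L : PeriodPair) {z v : ℂ}, z ∉ L.lattice → v ∉ L.lattice → ℘[L] z ≠ ℘[L] v → L.weierstrassZeta (z - v) - L.weierstrassZeta (z + v) = ℘'[L] v / (℘[L] z - ℘[L] v) - 2 * L.weierstrassZeta v := by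
  intro L z v hz hv hne
  have hv' : -v ∉ L.lattice := fun h => hv (by simpa using L.lattice.neg_mem h)
  have hne' : ℘[L] z ≠ ℘[L] (-v) := by rwa [L.weierstrassP_neg]
  have h1 := L.weierstrassZeta_add_holds z v hz hv hne
  have h2 := L.weierstrassZeta_add_holds z (-v) hz hv' hne'
  rw [sub_eq_add_neg z v, h2, h1, L.weierstrassZeta_neg, L.weierstrassP_neg, L.derivWeierstrassP_neg]
  have hd : ℘[L] z - ℘[L] v ≠ 0 := sub_ne_zero.2 hne
  field_simp
  ring

/-- `ω₁/2` is an algebraic point with `℘(ω₁/2) ≠ ℘(v)` whenever `2v ∉ Λ`. [folklore] -/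
theorem exists_algPt_weierstrassP_ne (L : PeriodPair) (h₂ : IsAlgebraic ℚ L.g₂) (h₃ : IsAlgebraic ℚ L.g₃) {v : ℂ}
    (hv : v ∉ L.lattice) (h2v : 2 * v ∉ L.lattice) :
    ∃ z₁ : ℂ, IsAlgPt L z₁ ∧ ℘[L] z₁ ≠ ℘[L] v := by
  refine ⟨L.ω₁ / 2, isAlgPt_of_torsion L h₂ h₃ L.ω₁_div_two_notMem_lattice (m := 2) two_pos ?_, fun h => ?_⟩
  · have e : ((2 : ℕ) : ℂ) * (L.ω₁ / 2) = L.ω₁ := by push_cast; ring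
    rw [e]; exact L.ω₁_mem_lattice
  · rcases (L.weierstrassP_eq_weierstrassP_iff L.ω₁_div_two_notMem_lattice hv).1 h with h' | h'
    · apply h2v
      have e : 2 * v = (L.ω₁ / 2 + v) + (L.ω₁ / 2 + v) - L.ω₁ := by ring
      rw [e]
      exact L.lattice.sub_mem (L.lattice.add_mem h' h') L.ω₁_mem_lattice
    · apply h2v
      have e : 2 * v = L.ω₁ - ((L.ω₁ / 2 - v) + (L.ω₁ / 2 - v)) := by ring
      rw [e]
      exact L.lattice.sub_mem L.ω₁_mem_lattice (L.lattice.add_mem h' h')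

/-- **Assembly of `stub_torsUnit` from the two worker statements.** [cite: WhittakerWatson1927, §20.53] [cite: SilvermanAEC2009, III.3.5] -/
theorem torsUnit_of (L : PeriodPair) (h₂ : IsAlgebraic ℚ L.g₂) (h₃ : IsAlgebraic ℚ L.g₃)
    (hPoly : ∀ {v : ℂ}, IsAlgPt L v → ∀ {N : ℕ}, 2 ≤ N →
      ∃ G : MvPolynomial (Fin 2) ℂ, HasAlgCoeffs G ∧
        (∃ z : ℂ, z ∉ L.lattice ∧ eval (phi L z) G ≠ 0) ∧
        (∃ F : ℂ → ℂ, AnalyticAt ℂ F 0 ∧ ∀ᶠ z in 𝓝[≠] (0 : ℂ), eval (phi L z) G = F z / z ^ N) ∧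
        (∃ q : ℂ → ℂ, AnalyticAt ℂ q v ∧ ∀ᶠ z in 𝓝 v, eval (phi L z) G = (z - v) ^ (N - 1) * q z))
    (hLiou : ∀ (v : ℂ), v ∉ L.lattice → ∀ r : ℂ → ℂ,
      (∀ z : ℂ, z ∉ L.lattice → (∀ l ∈ L.lattice, z ≠ v + l) → AnalyticAt ℂ r z) →
      (∀ z : ℂ, z ∉ L.lattice → (∀ l ∈ L.lattice, z ≠ v + l) → r (z + L.ω₁) = r z) →
      (∀ z : ℂ, z ∉ L.lattice → (∀ l ∈ L.lattice, z ≠ v + l) → r (z + L.ω₂) = r z) →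
      (∃ F₀ : ℂ → ℂ, AnalyticAt ℂ F₀ 0 ∧ ∀ᶠ z in 𝓝[≠] (0 : ℂ), r z = F₀ z) →
      (∃ F : ℂ → ℂ, AnalyticAt ℂ F v ∧ ∀ᶠ z in 𝓝[≠] v, r z = F z / (z - v)) →
      ∃ c : ℂ, ∀ z : ℂ, z ∉ L.lattice → (∀ l ∈ L.lattice, z ≠ v + l) → r z = c)
    {v : ℂ} (hv : IsAlgPt L v) {N : ℕ} (hN : 1 ≤ N) (hNv : (N : ℂ) * v ∈ L.lattice) (h2v : 2 * v ∉ L.lattice) :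
    ∃ (Gp Gm : MvPolynomial (Fin 2) ℂ) (c lam : ℂ), HasAlgCoeffs Gp ∧ HasAlgCoeffs Gm ∧
      IsAlgebraic ℚ c ∧ c ≠ 0 ∧ IsAlgebraic ℚ lam ∧
      (∀ z : ℂ, z ∉ L.lattice → eval (phi L z) Gp * eval (phi L z) Gm = c * (℘[L] z - ℘[L] v) ^ N) ∧
      (∀ z : ℂ, z ∉ L.lattice → ℘[L] z ≠ ℘[L] v →
        (∑ k, eval (phi L z) (pderiv k Gp) * phiD L z k) / eval (phi L z) Gp -
          (∑ k, eval (phi L z) (pderiv k Gm) * phiD L z k) / eval (phi L z) Gm =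
            (N : ℂ) * ℘'[L] v / (℘[L] z - ℘[L] v) - 2 * lam) := by
  have hv0 : v ∉ L.lattice := hv.1
  have hvneg : IsAlgPt L (-v) := hv.neg
  have hv0' : -v ∉ L.lattice := hvneg.1
  -- `N ≥ 2` (for `N = 1` the point `v` would be a lattice point)
  have hN2 : 2 ≤ N := by
    rcases Nat.lt_or_ge N 2 with h | h
    · exfalso
      have hN1 : N = 1 := by omega
      subst hN1
      exact hv0 (by simpa using hNv)
    · exact h
  -- `N v = m ω₁ + n ω₂`, `η = m η₁ + n η₂`
  obtain ⟨m, n, hmn⟩ := PeriodPair.mem_lattice.1 hNv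
  have hNv' : (N : ℂ) * v = m * L.ω₁ + n * L.ω₂ := hmn.symm
  have hNv'' : (N : ℂ) * (-v) = (-m : ℤ) * L.ω₁ + (-n : ℤ) * L.ω₂ := by rw [mul_neg, hNv']; push_cast; ring
  set η : ℂ := m * L.η₁ + n * L.η₂ with hη
  have hη' : -η = (-m : ℤ) * L.η₁ + (-n : ℤ) * L.η₂ := by rw [hη]; push_cast; ring
  -- the two polynomials and their identification with the σ-quotients
  obtain ⟨Gp, hGp, ⟨zp, hzp, hzp0⟩, hFp, hqp⟩ := hPoly hv hN2
  obtain ⟨Gm, hGm, ⟨zm, hzm, hzm0⟩, hFm, hqm⟩ := hPoly hvneg hN2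
  obtain ⟨cp, hcp⟩ := eval_phi_eq_const_mul_sigmaQuot L hv0 hN hNv' rfl Gp hFp hqp (hLiou v hv0)
  obtain ⟨cm, hcm⟩ := eval_phi_eq_const_mul_sigmaQuot L hv0' hN hNv'' hη' Gm hFm hqm (hLiou (-v) hv0')
  have hcp0 : cp ≠ 0 := by
    intro h0; apply hzp0; rw [hcp zp hzp, h0, zero_mul]
  have hcm0 : cm ≠ 0 := by
    intro h0; apply hzm0; rw [hcm zm hzm, h0, zero_mul]
  -- the product formula
  have hσv : L.weierstrassSigma v ≠ 0 := L.weierstrassSigma_ne_zero hv0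
  set c : ℂ := cp * cm * (-(L.weierstrassSigma v ^ 2)) ^ N with hc
  have hprod : ∀ z : ℂ, z ∉ L.lattice → eval (phi L z) Gp * eval (phi L z) Gm = c * (℘[L] z - ℘[L] v) ^ N := by
    intro z hz
    rw [hcp z hz, hcm z hz]
    have hσz : L.weierstrassSigma z ≠ 0 := L.weierstrassSigma_ne_zero hz
    have hsig := L.weierstrassP_sub_eq_sigma_holds z v hz hv0
    have e : L.weierstrassSigma (z - v) * L.weierstrassSigma (z + v) / L.weierstrassSigma z ^ 2 =
        -(L.weierstrassSigma v ^ 2) * (℘[L] z - ℘[L] v) := by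
      rw [hsig]; field_simp
    simp only [sigmaQuot, sub_neg_eq_add, hc]
    calc cp * ((L.weierstrassSigma (z - v) / L.weierstrassSigma z) ^ N * cexp (η * z)) *
          (cm * ((L.weierstrassSigma (z + v) / L.weierstrassSigma z) ^ N * cexp (-η * z)))
        = cp * cm * (L.weierstrassSigma (z - v) * L.weierstrassSigma (z + v) / L.weierstrassSigma z ^ 2) ^ N *
            (cexp (η * z) * cexp (-η * z)) := by rw [div_pow, div_pow, div_pow, mul_pow]; ring
      _ = cp * cm * (-(L.weierstrassSigma v ^ 2)) ^ N * (℘[L] z - ℘[L] v) ^ N := by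
          rw [← exp_add, show η * z + -η * z = 0 by ring, exp_zero, mul_one, e, mul_pow]; ring
  have hc0 : c ≠ 0 := mul_ne_zero (mul_ne_zero hcp0 hcm0) (pow_ne_zero _ (neg_ne_zero.2 (pow_ne_zero _ hσv)))
  -- `c` is algebraic: evaluate the product formula at the algebraic point `ω₁/2`
  have hcalg : IsAlgebraic ℚ c := by
    obtain ⟨z₁, hz₁, hne₁⟩ := exists_algPt_weierstrassP_ne L h₂ h₃ hv0 h2v
    have hd : (℘[L] z₁ - ℘[L] v) ^ N ≠ 0 := pow_ne_zero _ (sub_ne_zero.2 hne₁)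
    have e : c = eval (phi L z₁) Gp * eval (phi L z₁) Gm / (℘[L] z₁ - ℘[L] v) ^ N := by
      rw [hprod z₁ hz₁.1]; field_simp
    rw [e]
    exact ((hGp.isAlgebraic_eval hz₁.2).mul (hGm.isAlgebraic_eval hz₁.2)).mul
      ((hz₁.weierstrassP.sub hv.weierstrassP).pow N).inv
  -- `λ = N ζ(v) − η` is algebraic (torsion points of `E♮` are algebraic)
  have hNpos : 0 < N := hN
  have hlam : IsAlgebraic ℚ ((N : ℂ) * L.weierstrassZeta v - η) := by
    have hN0 : (N : ℂ) ≠ 0 := by exact_mod_cast hNpos.ne'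
    have hvq : v = ((m : ℂ) * L.ω₁ + n * L.ω₂) / N := by
      rw [eq_div_iff hN0, ← hNv']; ring
    rcases L.torsion_dichotomy h₂ h₃ m n hNpos with ⟨⟨a, ha⟩, ⟨b, hb⟩⟩ | ⟨-, -, halg⟩
    · exfalso
      apply hv0
      rw [hvq, ha, hb]
      push_cast
      have e : ((N : ℂ) * a * L.ω₁ + (N : ℂ) * b * L.ω₂) / N = a * L.ω₁ + b * L.ω₂ := by
        have hN0 : (N : ℂ) ≠ 0 := by exact_mod_cast hNpos.ne'
        field_simp
      rw [e]
      exact L.int_mul_add_int_mul_mem_lattice a b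
    · rw [← hvq] at halg
      have e : (N : ℂ) * L.weierstrassZeta v - η = -(N : ℂ) * (((m : ℂ) * L.η₁ + n * L.η₂) / N - L.weierstrassZeta v) := by
        have hN0 : (N : ℂ) ≠ 0 := by exact_mod_cast hNpos.ne'
        rw [hη]; field_simp; ring
      rw [e]
      exact (isAlgebraic_nat N).neg.mul halg
  refine ⟨Gp, Gm, c, (N : ℂ) * L.weierstrassZeta v - η, hGp, hGm, hcalg, hc0, hlam, hprod, fun z hz hne => ?_⟩
  -- the dlog identity
  have hzv : z - v ∉ L.lattice := fun h => hne ((L.weierstrassP_eq_weierstrassP_iff hz hv0).2 (Or.inr h))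
  have hzv' : z - -v ∉ L.lattice := fun h => hne ((L.weierstrassP_eq_weierstrassP_iff hz hv0).2 (Or.inl (by simpa using h)))
  rw [logDeriv_eval_phi_eq L hcp0 Gp hcp hz hzv, logDeriv_eval_phi_eq L hcm0 Gm hcm hz hzv', sub_neg_eq_add]
  have hζ := zeta_sub_sub_zeta_add L hz hv0 hne
  linear_combination (N : ℂ) * hζ

end TorsionLayer

end Summit.KontsevichZagierPeriods.SymplecticScissors.RealOnePeriodRelations

end
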